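/-
Copyright: harness cell b2b-lgcu-borel (gen 19).  Honest framing: the VALUE here is a THEOREM
(a decidable NEGATIVE verdict on an infinite slice of the crux) — NOT summit progress; the crux
item `SubgroupIdentityDesigns` (stmt-MatrixMultiplication-14079) stays open and untouched.
-/
import Mathlib
import Summits.MatrixMultiplication.MatrixMultiplication.Theorems.SubgroupIdentityDesigns.Negative.WitnessNeumannCounts
import Summits.MatrixMultiplication.MatrixMultiplication.Theorems.SubgroupIdentityDesigns.Negative.LevelOneFloorAll
import Summits.MatrixMultiplication.MatrixMultiplication.Theorems.SubgroupIdentityDesigns.Negative.PTwoAllDimensions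

/-!
# The level-one slice of `SubgroupIdentityDesigns` is empty at every prime `p ≤ 7`, in every
# dimension

Route `LevelGradedCohnUmans`, crux `SubgroupIdentityDesigns`, negative side; level `k = 1`, all
dimensions `m = 1 + l ≥ 2`.

* `no_levelOne_witness_small` : for **`p ∈ {3, 5, 7}`, every `l ≥ 1` and every `−2 < ε ≤ 1`**, no
  subgroup-TPP triple of `GL_{1+l}(𝔽_p)` carrying a level-one identity design satisfies the crux
  inequality `budget p (1+l) 1 (2+ε) < (|H₁||H₂||H₃|)^{(2+ε)/3}`.
  PROOF.  `b = (p^{1+l} − 1)/(p − 1)`, `D = dim F_1|_G ≤ (p−1) b² − 2b + 2`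
  (`LevelOneFloorAll.finrank_le_formula_nat`), the `ℓ^s` floor `V ≥ (p−1) b³ − 3b² + 3b + 1`
  (`LevelOneFloorAll.volume_gt_floor_nat`) and the VOLUME LAW `V ≤ u D − u³ + u²` of the two graded
  Neumann counts (`WitnessNeumannCounts.crux_volume_law`, `u = min(|H₁|, |H₃|)`).  The cubic
  certificate `u³ − u² − uD + F = (u − c)²(u + 2c − 1) + (3c² − 2c − D) u + (F − 2c³ + c²)`
  (`cubic_cert`) with `c = (9/10) b`, `(6/5) b`, `(71/50) b` for `p = 3, 5, 7` (`cert_three/five/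
  seven`; for `p = 7` it needs `b ≥ 57`, i.e. `l ≥ 2`) makes floor and law incompatible for every
  real `u ≥ 0`; the one remaining cell `(p, l) = (7, 1)` (`b = 8`, `D ≤ 370`, `V ≥ 2905`) is the
  finite check `max_{1 ≤ u ≤ 19} (370 u − u³ + u²) = 2860 < 2905`.  The law FAILS to exclude
  `p ≥ 11` (`max_u (uD − u³ + u²) ≈ 0.385 (p−1)^{3/2} b³ > (p−1) b³` iff `p − 1 > 27/4`), which is
  why `11` is the first open prime of the level-one slice in dimension `≥ 3`.
* `no_crux_instance_small_all` : the crux clause verbatim, packaged over all `m ≥ 2`, for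
  `p ∈ {3, 5, 7}` and `0 < ε ≤ 1`;
* `no_crux_instance_le_seven` : together with `PTwoAllDimensions.no_crux_instance_pTwo_all`
  (`p = 2`, every `ε > 0`): **for every prime `p ≤ 7`, every `0 < ε ≤ 1` and every `m ≥ 2` there is
  no subgroup triple of `GL_m(𝔽_p)` witnessing `SubgroupIdentityDesigns` at level one.**

This supersedes, for these primes, the dimension-two results (`LevelOneFloor`, the `(2,1)` census
files) and the `(m,1)` squeeze `LevelOneDimSqueeze` (which needs `p = 2` or large `ε`).
Sorry-free; standard axioms; no new definitions.  Report:
`run/shared/lean/b2b/levelgraded-cu/ORACLE-g19.md` §G19-3.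
-/

set_option linter.dupNamespace false

noncomputable section

open scoped BigOperators Classical Matrix
open Module (finrank)

namespace Summit.MatrixMultiplication.MatrixMultiplication.Theorems.SubgroupIdentityDesigns.Negative
namespace LevelOneSmallPrimes

open Literature.Barriers.MatrixMultiplication (SubgroupTPP)
open Summit.MatrixMultiplication.MatrixMultiplication.Theorems.LieRankDesigns.Negative
  (GLm Mat budget)
open Summit.MatrixMultiplication.MatrixMultiplication.Theorems.LevelOneGL2Designs.Negative
  (levelSubmodule)
open WitnessNeumannCounts (crux_volume_law)
open LevelOneFloorAll (volume_gt_floor_nat finrank_le_formula_nat succ_le_b sq_succ_le_b)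

/-! ## The cubic certificate -/

/-- **THE CUBIC CERTIFICATE.**  `u³ − u² − uD + F = (u − c)²(u + 2c − 1) + (3c² − 2c − D) u +
(F − 2c³ + c²)`; so `D ≤ 3c² − 2c` and `2c³ − c² < F` give `u D − u³ + u² < F` for all `u ≥ 0`. -/
theorem cubic_cert {u c D F : ℝ} (hu0 : 0 ≤ u) (hc : 1 ≤ 2 * c) (hα : D ≤ 3 * c ^ 2 - 2 * c)
    (hβ : 2 * c ^ 3 - c ^ 2 < F) : u * D - u ^ 3 + u ^ 2 < F := by
  nlinarith [mul_nonneg (sq_nonneg (u - c)) (by linarith : (0 : ℝ) ≤ u + 2 * c - 1),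
    mul_nonneg (sub_nonneg.2 hα) hu0]

/-- `p = 3`: `c = (9/10) b`, `b ≥ 4`, `D ≤ 2b² − 2b + 2`, `F = 2b³ − 3b² + 3b + 1`. -/
theorem cert_three {u b D : ℝ} (hu0 : 0 ≤ u) (hb : 4 ≤ b) (hD : D ≤ 2 * b ^ 2 - 2 * b + 2) :
    u * D - u ^ 3 + u ^ 2 < 2 * b ^ 3 - 3 * b ^ 2 + 3 * b + 1 := by
  refine cubic_cert (c := 9 / 10 * b) hu0 (by linarith) ?_ ?_
  · nlinarith [mul_nonneg (by linarith : (0 : ℝ) ≤ b - 4) (by linarith : (0 : ℝ) ≤ b)]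
  · nlinarith [pow_nonneg (by linarith : (0 : ℝ) ≤ b - 4) 3, sq_nonneg (b - 4)]

/-- `p = 5`: `c = (6/5) b`, `b ≥ 6`, `D ≤ 4b² − 2b + 2`, `F = 4b³ − 3b² + 3b + 1`. -/
theorem cert_five {u b D : ℝ} (hu0 : 0 ≤ u) (hb : 6 ≤ b) (hD : D ≤ 4 * b ^ 2 - 2 * b + 2) :
    u * D - u ^ 3 + u ^ 2 < 4 * b ^ 3 - 3 * b ^ 2 + 3 * b + 1 := by
  refine cubic_cert (c := 6 / 5 * b) hu0 (by linarith) ?_ ?_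
  · nlinarith [mul_nonneg (by linarith : (0 : ℝ) ≤ b - 6) (by linarith : (0 : ℝ) ≤ b)]
  · nlinarith [pow_nonneg (by linarith : (0 : ℝ) ≤ b - 6) 3, sq_nonneg (b - 6)]

/-- `p = 7`, `l ≥ 2`: `c = (71/50) b`, `b ≥ 57`, `D ≤ 6b² − 2b + 2`, `F = 6b³ − 3b² + 3b + 1`. -/
theorem cert_seven {u b D : ℝ} (hu0 : 0 ≤ u) (hb : 57 ≤ b) (hD : D ≤ 6 * b ^ 2 - 2 * b + 2) :
    u * D - u ^ 3 + u ^ 2 < 6 * b ^ 3 - 3 * b ^ 2 + 3 * b + 1 := by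
  refine cubic_cert (c := 71 / 50 * b) hu0 (by linarith) ?_ ?_
  · nlinarith [mul_nonneg (by linarith : (0 : ℝ) ≤ b - 57) (by linarith : (0 : ℝ) ≤ b)]
  · nlinarith [pow_nonneg (by linarith : (0 : ℝ) ≤ b - 57) 3, sq_nonneg (b - 57)]

/-! ## The level-one slice at `p ∈ {3, 5, 7}` -/

variable {p : ℕ} [hp : Fact p.Prime] {l : ℕ}

/-- **NO LEVEL-ONE WITNESS AT `p ∈ {3, 5, 7}` IN ANY DIMENSION** (`l ≥ 1`, `−2 < ε ≤ 1`). -/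
theorem no_levelOne_witness_small (hp357 : p = 3 ∨ p = 5 ∨ p = 7) (hl : 1 ≤ l) {ε : ℝ}
    (hε : -2 < ε) (hε1 : ε ≤ 1) {H₁ H₂ H₃ : Subgroup (GLm p (1 + l))}
    (htpp : SubgroupTPP H₁ H₂ H₃)
    (hdes : ∃ c : Mat p (1 + l) → ℂ, (∀ M, 1 < M.rank → c M = 0) ∧
      (∑ M, c M * ZMod.stdAddChar (Matrix.trace (M * ((1 : GLm p (1 + l)) : Mat p (1 + l))))) = 1 ∧
      ∀ a ∈ H₁, ∀ b ∈ H₂, ∀ g ∈ H₃, a * b * g ≠ 1 →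
        (∑ M, c M * ZMod.stdAddChar
          (Matrix.trace (M * ((a * b * g : GLm p (1 + l)) : Mat p (1 + l))))) = 0) :
    ¬ budget p (1 + l) 1 (2 + ε) <
      ((Nat.card H₁ * Nat.card H₂ * Nat.card H₃ : ℕ) : ℝ) ^ ((2 + ε) / 3) := by
  intro hlt
  obtain ⟨u, hu1, -, -, -, huu, hvol⟩ := crux_volume_law (k := 1) htpp hdes
  have hF := volume_gt_floor_nat (p := p) hl hε hε1 hlt
  have hD := finrank_le_formula_nat (p := p) (l := l)
  have hb1 := succ_le_b (p := p) hl
  have hp1 : 1 ≤ p := hp.out.one_lt.le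
  by_cases h71 : p = 7 ∧ l = 1
  · -- the cell `(p, l) = (7, 1)`: `b = 8`, `D ≤ 370`, `V ≥ 2905`, finite check over `u ≤ 19`
    obtain ⟨rfl, rfl⟩ := h71
    have hb8 : (7 ^ (1 + 1) - 1) / (7 - 1) = 8 := by norm_num
    rw [hb8] at hF hD
    generalize finrank ℂ (levelSubmodule 7 (1 + 1) 1) = D at hD huu hvol
    generalize Nat.card H₁ * Nat.card H₂ * Nat.card H₃ = V at hF hvol
    norm_num at hF hD
    have hu : u ≤ 19 := by
      by_contra h
      push Not at h
      have h400 : 20 * 20 ≤ u * u := Nat.mul_le_mul h h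
      omega
    interval_cases u <;> omega
  · have hb2 : p = 7 → 7 ^ 2 + 7 + 1 ≤ (p ^ (1 + l) - 1) / (p - 1) := by
      rintro rfl
      exact sq_succ_le_b (p := 7) (by omega)
    generalize (p ^ (1 + l) - 1) / (p - 1) = b at hF hD hb1 hb2
    generalize finrank ℂ (levelSubmodule p (1 + l) 1) = D at hD huu hvol
    generalize Nat.card H₁ * Nat.card H₂ * Nat.card H₃ = V at hF hvol
    have hvolR : (V : ℝ) + (u : ℝ) * u * ((u : ℝ) - 1) ≤ (u : ℝ) * D := by
      have h : ((V + u * u * (u - 1) : ℕ) : ℝ) ≤ ((u * D : ℕ) : ℝ) := by exact_mod_cast hvol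
      push_cast [Nat.cast_sub hu1] at h
      exact h
    have hV : (V : ℝ) ≤ u * D - (u : ℝ) ^ 3 + (u : ℝ) ^ 2 := by nlinarith [hvolR]
    have hFR : ((p : ℝ) - 1) * (b : ℝ) ^ 3 + 3 * b + 1 ≤ (V : ℝ) + 3 * (b : ℝ) ^ 2 := by
      have h : (((p - 1) * b ^ 3 + 3 * b + 1 : ℕ) : ℝ) ≤ ((V + 3 * b ^ 2 : ℕ) : ℝ) := by
        exact_mod_cast hF
      push_cast [Nat.cast_sub hp1] at h
      exact h
    have hDR : (D : ℝ) + 2 * b ≤ ((p : ℝ) - 1) * (b : ℝ) ^ 2 + 2 := by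
      have h : ((D + 2 * b : ℕ) : ℝ) ≤ (((p - 1) * b ^ 2 + 2 : ℕ) : ℝ) := by exact_mod_cast hD
      push_cast [Nat.cast_sub hp1] at h
      exact h
    have hu0 : (0 : ℝ) ≤ u := Nat.cast_nonneg _
    rcases hp357 with rfl | rfl | rfl
    · have hb4 : (4 : ℝ) ≤ b := by exact_mod_cast hb1
      norm_num at hFR hDR
      have hc := cert_three (D := (D : ℝ)) hu0 hb4 (by linarith)
      linarith
    · have hb6 : (6 : ℝ) ≤ b := by exact_mod_cast hb1
      norm_num at hFR hDR
      have hc := cert_five (D := (D : ℝ)) hu0 hb6 (by linarith)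
      linarith
    · have hb57 : (57 : ℝ) ≤ b := by
        have h := hb2 rfl
        norm_num at h
        have hl2 : 57 ≤ b := h
        exact_mod_cast hl2
      norm_num at hFR hDR
      have hc := cert_seven (D := (D : ℝ)) hu0 hb57 (by linarith)
      linarith

/-- **The crux clause verbatim has no level-one instance at `p ∈ {3, 5, 7}`**, in any dimension
`m ≥ 2`, for `0 < ε ≤ 1`. -/
theorem no_crux_instance_small_all (hp357 : p = 3 ∨ p = 5 ∨ p = 7) {ε : ℝ} (hε : 0 < ε)
    (hε1 : ε ≤ 1) :
    ¬ ∃ (m : ℕ) (_ : 2 ≤ m)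
      (H₁ H₂ H₃ : Subgroup (Matrix.GeneralLinearGroup (Fin m) (ZMod p))),
      Literature.Barriers.MatrixMultiplication.SubgroupTPP H₁ H₂ H₃ ∧
      (∃ c : Matrix (Fin m) (Fin m) (ZMod p) → ℂ, (∀ M, 1 < M.rank → c M = 0) ∧
        (∑ M : Matrix (Fin m) (Fin m) (ZMod p), c M * ZMod.stdAddChar
          (Matrix.trace (M * ((1 : Matrix.GeneralLinearGroup (Fin m) (ZMod p)) :
            Matrix (Fin m) (Fin m) (ZMod p))))) = 1 ∧
        ∀ a ∈ H₁, ∀ b ∈ H₂, ∀ g ∈ H₃, a * b * g ≠ 1 →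
          (∑ M : Matrix (Fin m) (Fin m) (ZMod p), c M * ZMod.stdAddChar
            (Matrix.trace (M * ((a * b * g : Matrix.GeneralLinearGroup (Fin m) (ZMod p)) :
              Matrix (Fin m) (Fin m) (ZMod p))))) = 0) ∧
      (∑ᶠ χ ∈ Literature.RepresentationTheory.FiniteGroups.irrChars
          (Matrix.GeneralLinearGroup (Fin m) (ZMod p)) ∩
          {f | ∃ c : Matrix (Fin m) (Fin m) (ZMod p) → ℂ, (∀ M, 1 < M.rank → c M = 0) ∧
            ∀ g : Matrix.GeneralLinearGroup (Fin m) (ZMod p), f g =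
              ∑ M : Matrix (Fin m) (Fin m) (ZMod p), c M * ZMod.stdAddChar
                (Matrix.trace (M * (g : Matrix (Fin m) (Fin m) (ZMod p))))},
        (χ 1).re ^ (2 + ε)) <
        ((Nat.card H₁ * Nat.card H₂ * Nat.card H₃ : ℕ) : ℝ) ^ ((2 + ε) / 3) := by
  rintro ⟨m, hm, H₁, H₂, H₃, htpp, hdesign, hlt⟩
  obtain ⟨l, rfl⟩ : ∃ l, m = 1 + l := ⟨m - 1, by omega⟩
  exact no_levelOne_witness_small hp357 (by omega) (by linarith) hε1 htpp hdesign hlt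

/-- **THE LEVEL-ONE SLICE IS EMPTY AT EVERY PRIME `p ≤ 7`, IN EVERY DIMENSION `m ≥ 2`, FOR
`0 < ε ≤ 1`** (`p = 2`: `PTwoAllDimensions`; `p ∈ {3, 5, 7}`: the volume law). -/
theorem no_crux_instance_le_seven (hp7 : p ≤ 7) {ε : ℝ} (hε : 0 < ε) (hε1 : ε ≤ 1) :
    ¬ ∃ (m : ℕ) (_ : 2 ≤ m)
      (H₁ H₂ H₃ : Subgroup (Matrix.GeneralLinearGroup (Fin m) (ZMod p))),
      Literature.Barriers.MatrixMultiplication.SubgroupTPP H₁ H₂ H₃ ∧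
      (∃ c : Matrix (Fin m) (Fin m) (ZMod p) → ℂ, (∀ M, 1 < M.rank → c M = 0) ∧
        (∑ M : Matrix (Fin m) (Fin m) (ZMod p), c M * ZMod.stdAddChar
          (Matrix.trace (M * ((1 : Matrix.GeneralLinearGroup (Fin m) (ZMod p)) :
            Matrix (Fin m) (Fin m) (ZMod p))))) = 1 ∧
        ∀ a ∈ H₁, ∀ b ∈ H₂, ∀ g ∈ H₃, a * b * g ≠ 1 →
          (∑ M : Matrix (Fin m) (Fin m) (ZMod p), c M * ZMod.stdAddChar
            (Matrix.trace (M * ((a * b * g : Matrix.GeneralLinearGroup (Fin m) (ZMod p)) :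
              Matrix (Fin m) (Fin m) (ZMod p))))) = 0) ∧
      (∑ᶠ χ ∈ Literature.RepresentationTheory.FiniteGroups.irrChars
          (Matrix.GeneralLinearGroup (Fin m) (ZMod p)) ∩
          {f | ∃ c : Matrix (Fin m) (Fin m) (ZMod p) → ℂ, (∀ M, 1 < M.rank → c M = 0) ∧
            ∀ g : Matrix.GeneralLinearGroup (Fin m) (ZMod p), f g =
              ∑ M : Matrix (Fin m) (Fin m) (ZMod p), c M * ZMod.stdAddChar
                (Matrix.trace (M * (g : Matrix (Fin m) (Fin m) (ZMod p))))},
        (χ 1).re ^ (2 + ε)) <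
        ((Nat.card H₁ * Nat.card H₂ * Nat.card H₃ : ℕ) : ℝ) ^ ((2 + ε) / 3) := by
  have h2 := hp.out.two_le
  have hcases : p = 2 ∨ (p = 3 ∨ p = 5 ∨ p = 7) := by
    have hpr := hp.out
    interval_cases p <;> first | omega | exact absurd hpr (by norm_num)
  rcases hcases with rfl | h357
  · exact PTwoAllDimensions.no_crux_instance_pTwo_all hε
  · exact no_crux_instance_small_all h357 hε hε1

end LevelOneSmallPrimes

end Summit.MatrixMultiplication.MatrixMultiplication.Theorems.SubgroupIdentityDesigns.Negative
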